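import Literature.NumberTheory.Automorphic.IteratedColumnAverages
import Literature.NumberTheory.Automorphic.BesselDescentLevel
import HarnessLib

/-!
# The explicit Bessel descent at a finite level: the tower of descended forms on graded vectors

Topic `NumberTheory/Automorphic`; namespace `Literature.NumberTheory.Automorphic.WhittakerBessel`.
Definitions with bodies (`gradExp`, `aGr`, `eGr`, `colIter`) and theorems; no named fact, no instance,
no `sorry`.

Let `(ρ, V)` be a smooth representation of `GL_n(F)`, `B` an invariant positive semi-definite Hermitian
form, `Λ` a `ψ`-Whittaker functional (`ψ` of conductor `𝒪`) and `Φ_0 = B, Φ_1, …, Φ_m` (`n = m + 1`) the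
tower of descended forms of `SatakeParameterGenericBoundHolds` (`levelForm`). The descended form is an
eventual value `Φ'(v, w) = lim_N q^{Nt} Φ(e_{-N} v, e_{-N} w)`; this file makes it **explicit on graded
vectors**. Fix a level `L ≥ 1` and the grading element `t₀ = diag(ϖ^{2Li})` (`gradExp`). For
`x = ρ(t₀) y` with `y` fixed by the lower triangular part of `K(L)` (and by some `K(L₀)`), the descent
thresholds are controlled (`descendForm_eq_dStep_of`), the coarse projector of the **graded lattice**
`ϖ^{(i-t)2L + L} 𝒪` at the standard character collapses onto the square ones
(`form_proj_proj_eq_card_mul` of the tree), and conjugation by `t₀` turns the graded projectors into the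
uniform twisted column averages of `IteratedColumnAverages` (`apply_gradElem_proj`). The result is the
**explicit descent formula** `Φ_m(x, x) = q^{e} B(z, z)` with `z = colIter n y` the canonical iterated
column average of `y` and `e = ∑_t L t²` (`levelForm_graded_eq`), where `z` is fixed by `K(2L)` and
`Λ(ρ(t₀) z) = Λ(x)`. With a bound `|Λ w|² ≤ C · B(w, w)` on vectors of a fixed level this bounds `|Λ x|²` by
`Φ_m(x, x)` (`norm_sq_whittaker_graded_le`), and `bessel_bound_level` then gives the **Kirillov `L²`-bound on a
torus window** `∑_{(λ,μ)} q^{w(λ)} |Λ(ρ(ϖ^λ D_μ) v)|² ≤ C' B(v, v)` for `v` of level `K(ℓ)` and `λ` in the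
near-antitone window forced by the support of Whittaker functions (`sum_norm_sq_whittaker_le`; the
support condition is `whittaker_torusElem_eq_zero`, and `sum_norm_sq_whittaker_le_of_shells` is the bound
on an arbitrary finite torus box). This is the
finite-place half of the absolute convergence of the local Rankin–Selberg integrals at `s = 1`
(Jacquet–Shalika 1981, §1; Jacquet–Piatetski-Shapiro–Shalika 1983, (2.7)) in a classification-free form.

## References

* H. Jacquet, J. A. Shalika, Amer. J. Math. 103 (1981), §1 [JacquetShalikaAJM1981].
* I. N. Bernstein, A. V. Zelevinsky, Russian Math. Surveys 31:3 (1976), §5 [BernsteinZelevinsky1976].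
-/

noncomputable section

open scoped MatrixGroups Classical
open ValuativeRel Matrix Finset

namespace Literature.NumberTheory.Automorphic

namespace WhittakerBessel

open WhittakerSupercuspidal

variable {F : Type*} [Field F] [ValuativeRel F] {n : ℕ}

/-! ### The grading element and the graded lattices -/

omit [ValuativeRel F] in
/-- The exponents `(0, 2L, 4L, …)` of the grading torus element `t₀ = diag(ϖ^{2Li})`. [folklore] -/
def gradExp (n : ℕ) (L : ℤ) : Fin n → ℤ := fun i => (i : ℤ) * (2 * L)

omit [ValuativeRel F] in
/-- Entries of `gradExp`. [folklore] -/
@[simp] theorem gradExp_apply (L : ℤ) (i : Fin n) : gradExp n L i = (i : ℤ) * (2 * L) := rfl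

omit [ValuativeRel F] in
/-- The **graded column lattice** of the column `t`: exponents `(i - t) 2L + L` (the transport of the square
lattice `ϖ^L 𝒪^t` under `t₀`). [folklore] -/
def aGr (n : ℕ) (L : ℤ) (t : Fin n) : Fin n → ℤ := fun i => (gradExp n L i - gradExp n L t) + cLat n L i

omit [ValuativeRel F] in
/-- Entries of `aGr`. [folklore] -/
theorem aGr_apply (L : ℤ) (t i : Fin n) : aGr n L t i = ((i : ℤ) - t) * (2 * L) + L := by
  simp only [aGr, gradExp_apply, cLat_apply]; ring

omit [ValuativeRel F] in
/-- The graded exponents are `≤ -L` above the diagonal. [folklore] -/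
theorem aGr_le {L : ℤ} (hL : 0 ≤ L) {t i : Fin n} (hi : i < t) : aGr n L t i ≤ -L := by
  rw [aGr_apply]
  have : (i : ℤ) - t ≤ -1 := by have := Fin.lt_def.1 hi; omega
  nlinarith

omit [ValuativeRel F] in
/-- The **descent exponent** of the column `t`: `e_t = ∑_{i<t} -(aGr)_i` (`= L t²`). [folklore] -/
def eGr (n : ℕ) (L : ℤ) (t : Fin n) : ℕ := ∑ i : {i : Fin n // i < t}, (-aGr n L t i).toNat

omit [ValuativeRel F] in
/-- **The transported character is the standard one**: `(ϖ^{-2L} e_{t-1})_i ϖ^{-(2Li - 2Lt)} = e_{t-1}`.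
[folklore] -/
theorem colCharAt_mul_zpow {ϖ : F} (hϖ0 : ϖ ≠ 0) (L : ℤ) {t tp : Fin n} (htp : (tp : ℕ) + 1 = t) :
    (fun i => colCharAt ϖ L t i * ϖ ^ (-(gradExp n L i - gradExp n L t))) = Pi.single tp (1 : F) := by
  funext i
  rw [colCharAt_apply, gradExp_apply, gradExp_apply]
  by_cases hi : (i : ℕ) + 1 = (t : ℕ)
  · have hit : i = tp := Fin.ext (by omega)
    subst hit
    rw [if_pos hi, Pi.single_eq_same, ← zpow_add₀ hϖ0]
    have : -(2 * L) + -((i : ℤ) * (2 * L) - (t : ℤ) * (2 * L)) = 0 := by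
      have : (t : ℤ) = (i : ℤ) + 1 := by omega
      rw [this]; ring
    rw [this, zpow_zero]
  · have hit : i ≠ tp := fun h => hi (by rw [h]; exact htp)
    rw [if_neg hi, zero_mul, Pi.single_eq_of_ne hit]

/-! ### Conjugation of graded row shears and of deep congruence elements by the grading element -/

/-- **Graded row shears become lower Iwahori elements of level `L`**: for `c_i ∈ ϖ^{(t-i)2L - L} 𝒪`
(`i < t`, `c_i = 0` for `i ≥ t`), the conjugate `t₀⁻¹ (1 + e_{t-1} ⊗ c) t₀` is `≡ 1 (mod ϖ^L)`, the identity
outside its top-left `t × t` corner, and lower triangular. [folklore] -/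
theorem conj_rowShear_graded {ϖ : F} (hϖ0 : ϖ ≠ 0) {L : ℤ} {t tp : Fin n}
    (htp : (tp : ℕ) + 1 = t) {c : Fin n → F} (hc : c ∈ colLat ϖ t (-aGr n L t)) (h : 1 + c tp ≠ 0) :
    ValBound (valuation F (ϖ ^ L))
        ((((zpowDiagGL hϖ0 (gradExp n L))⁻¹ * rowShear tp c h * zpowDiagGL hϖ0 (gradExp n L) : GL (Fin n) F) :
          Matrix (Fin n) (Fin n) F) - 1) ∧
      IsTopLeftNat (t : ℕ) (((zpowDiagGL hϖ0 (gradExp n L))⁻¹ * rowShear tp c h * zpowDiagGL hϖ0 (gradExp n L) :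
        GL (Fin n) F) : Matrix (Fin n) (Fin n) F) ∧
      (zpowDiagGL hϖ0 (gradExp n L))⁻¹ * rowShear tp c h * zpowDiagGL hϖ0 (gradExp n L) ∈
        oppositeParabolicGL F (id : Fin n → Fin n) := by
  have htpt : tp < t := Fin.lt_def.2 (by omega)
  have hent : ∀ i j, (((zpowDiagGL hϖ0 (gradExp n L))⁻¹ * rowShear tp c h * zpowDiagGL hϖ0 (gradExp n L) :
      GL (Fin n) F) : Matrix (Fin n) (Fin n) F) i j =
        (if i = j then 1 else 0) + if i = tp then ϖ ^ (gradExp n L j - gradExp n L tp) * c j else 0 := by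
    intro i j
    rw [coe_zpowDiagGL_inv_mul_mul_apply, coe_rowShear, Matrix.add_apply, Matrix.one_apply, rowMat_apply, mul_add]
    congr 1
    · split_ifs with hij
      · subst hij; rw [sub_self, zpow_zero, one_mul]
      · rw [mul_zero]
    · split_ifs with hi
      · subst hi; rfl
      · rw [mul_zero]
  have hczero : ∀ j, ¬ j < t → c j = 0 := hc.2
  refine ⟨fun i j => ?_, fun i j hij => ?_, (mem_oppositeParabolicGL_iff _).2 fun i j hij => ?_⟩
  · rw [Matrix.sub_apply, hent, Matrix.one_apply, add_sub_cancel_left]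
    split_ifs with hi
    · subst hi
      by_cases hj : j < t
      · have hcj := mem_zBall_iff.1 (hc.1 j hj)
        rw [map_mul, gradExp_apply, gradExp_apply]
        calc valuation F (ϖ ^ ((j : ℤ) * (2 * L) - (i : ℤ) * (2 * L))) * valuation F (c j)
            ≤ valuation F (ϖ ^ ((j : ℤ) * (2 * L) - (i : ℤ) * (2 * L))) * valuation F (ϖ ^ ((-aGr n L t) j)) := by
              gcongr
          _ = valuation F (ϖ ^ L) := by
              rw [← map_mul, ← zpow_add₀ hϖ0, Pi.neg_apply, aGr_apply]
              congr 2
              have : (t : ℤ) = (i : ℤ) + 1 := by have := htp; omega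
              rw [this]; ring
      · rw [hczero j hj, mul_zero, map_zero]; exact zero_le
    · rw [map_zero]; exact zero_le
  · rw [hent]
    split_ifs with hij' hi hi
    · subst hi
      have hj : ¬ j < t := by
        subst hij'
        rcases hij with h' | h' <;> exact not_lt.2 (Fin.le_def.2 h')
      rw [hczero j hj, mul_zero, add_zero]
    · rw [add_zero]
    · subst hi
      have hj : ¬ j < t := by
        rcases hij with h' | h'
        · exact absurd (Fin.lt_def.1 htpt) (by omega)
        · exact not_lt.2 (Fin.le_def.2 h')
      rw [hczero j hj, mul_zero, add_zero]
    · rw [add_zero]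
  · simp only [id] at hij
    rw [hent, if_neg (ne_of_lt hij), zero_add]
    split_ifs with hi
    · subst hi
      have hj : ¬ j < t := fun hj => by
        have := Fin.lt_def.1 hij; have := Fin.lt_def.1 hj; omega
      rw [hczero j hj, mul_zero]
    · rfl

/-- **Deep congruence elements conjugate into `K(2L)`**: `t₀⁻¹ K(ϖ^{2Ln}) t₀ ⊆ K(ϖ^{2L})` (`L ≥ 1`).
[folklore] -/
theorem conj_gradElem_mem_congruenceGL {ϖ : F} (hϖ : IsUniformizingElement ϖ) {L : ℤ} (hL : 1 ≤ L)
    {g : GL (Fin n) F} (hg : g ∈ congruenceGL n (valuation F (ϖ ^ (2 * L * n)))) :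
    (zpowDiagGL hϖ.ne_zero (gradExp n L))⁻¹ * g * zpowDiagGL hϖ.ne_zero (gradExp n L) ∈
      congruenceGL n (valuation F (ϖ ^ (2 * L))) := by
  have hγ1 : valuation F (ϖ ^ (2 * L)) < 1 := by
    obtain ⟨k, hk⟩ := Int.eq_ofNat_of_zero_le (by omega : (0 : ℤ) ≤ 2 * L)
    rw [hk, zpow_natCast, map_pow]; exact pow_lt_one' hϖ.valuation_lt_one (by omega)
  refine mem_congruenceGL_of_valBound_sub_one hγ1 fun i j => ?_
  have hent : ((((zpowDiagGL hϖ.ne_zero (gradExp n L))⁻¹ * g * zpowDiagGL hϖ.ne_zero (gradExp n L) : GL (Fin n) F) :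
      Matrix (Fin n) (Fin n) F) - 1) i j =
        ϖ ^ (gradExp n L j - gradExp n L i) * (((g : GL (Fin n) F) : Matrix (Fin n) (Fin n) F) - 1) i j := by
    rw [Matrix.sub_apply, coe_zpowDiagGL_inv_mul_mul_apply, Matrix.sub_apply, mul_sub, Matrix.one_apply]
    split_ifs with hij
    · subst hij; rw [sub_self, zpow_zero, one_mul, mul_one]
    · rw [mul_zero]
  rw [hent, map_mul, gradExp_apply, gradExp_apply]
  calc valuation F (ϖ ^ ((j : ℤ) * (2 * L) - (i : ℤ) * (2 * L))) * valuation F ((((g : GL (Fin n) F) :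
        Matrix (Fin n) (Fin n) F) - 1) i j)
      ≤ valuation F (ϖ ^ ((j : ℤ) * (2 * L) - (i : ℤ) * (2 * L))) * valuation F (ϖ ^ (2 * L * n)) := by
        gcongr; exact hg.2.1 i j
    _ = valuation F (ϖ ^ ((j : ℤ) * (2 * L) - (i : ℤ) * (2 * L) + 2 * L * n)) := by rw [← map_mul, ← zpow_add₀ hϖ.ne_zero]
    _ ≤ valuation F (ϖ ^ (2 * L)) := valuation_zpow_le_of_le hϖ.ne_zero hϖ.valuation_le_one (by
        have hi := i.2; have hj : (0 : ℤ) ≤ j := by positivity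
        have : ((i : ℕ) : ℤ) + 1 ≤ n := by exact_mod_cast hi
        nlinarith)

omit [ValuativeRel F] in
/-- Entries of the conjugate of `g` by a diagonal matrix of units: `(D⁻¹ g D)_{ij} = w_i⁻¹ g_{ij} w_j`. [folklore] -/
theorem coe_diagonalGL_inv_mul_mul_apply (w : Fin n → Fˣ) (g : GL (Fin n) F) (i j : Fin n) :
    (((diagonalGL (Fin n) F w)⁻¹ * g * diagonalGL (Fin n) F w : GL (Fin n) F) : Matrix (Fin n) (Fin n) F) i j =
      ((w i : F))⁻¹ * (g : Matrix (Fin n) (Fin n) F) i j * (w j : F) := by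
  rw [← map_inv, Units.val_mul, Units.val_mul, coe_diagonalGL, coe_diagonalGL, Matrix.mul_diagonal, Matrix.diagonal_mul,
    Pi.inv_apply, Units.val_inv_eq_inv_val]

omit [ValuativeRel F] in
/-- Conjugates of upper unitriangular elements by the grading element are upper unitriangular, with
superdiagonal sum scaled by `ϖ^{-2L}`. [folklore] -/
theorem gradElem_conj_unitriangular {ϖ : F} (hϖ0 : ϖ ≠ 0) (L : ℤ) (u : ↥(upperUnitriangular (Fin n) F)) :
    zpowDiagGL hϖ0 (gradExp n L) * (u : GL (Fin n) F) * (zpowDiagGL hϖ0 (gradExp n L))⁻¹ ∈ upperUnitriangular (Fin n) F ∧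
      ∀ h : zpowDiagGL hϖ0 (gradExp n L) * (u : GL (Fin n) F) * (zpowDiagGL hϖ0 (gradExp n L))⁻¹ ∈ upperUnitriangular (Fin n) F,
        superdiagSum ⟨_, h⟩ = ϖ ^ (-(2 * L)) * superdiagSum u := by
  have hu := (mem_unipotentRadicalGL_iff_apply (u : GL (Fin n) F)).1 u.2
  refine ⟨(mem_unipotentRadicalGL_iff_apply _).2 fun i j hij => ?_, fun h => ?_⟩
  · rw [coe_zpowDiagGL_mul_mul_inv_apply, hu i j hij, Matrix.one_apply]
    split_ifs with hij'
    · subst hij'; rw [sub_self, zpow_zero, one_mul]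
    · rw [mul_zero]
  · rw [superdiagSum_def, superdiagSum_def, Finset.mul_sum]
    refine Finset.sum_congr rfl fun i _ => ?_
    rw [Finset.mul_sum]
    refine Finset.sum_congr rfl fun j _ => ?_
    split_ifs with hij
    · change (((zpowDiagGL hϖ0 (gradExp n L) * (u : GL (Fin n) F) * (zpowDiagGL hϖ0 (gradExp n L))⁻¹ : GL (Fin n) F)) :
          Matrix (Fin n) (Fin n) F) i j = _
      rw [coe_zpowDiagGL_mul_mul_inv_apply, gradExp_apply, gradExp_apply]
      have : (i : ℤ) * (2 * L) - (j : ℤ) * (2 * L) = -(2 * L) := by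
        have : ((j : ℕ) : ℤ) = (i : ℤ) + 1 := by exact_mod_cast hij.symm
        rw [this]; ring
      rw [this]
    · rw [mul_zero]

section General

variable {V : Type*} [AddCommGroup V] [Module ℂ V] {ρ : Representation ℂ (GL (Fin n) F) V}
  {ψ : AddChar F Circle} {ϖ : F}

omit [ValuativeRel F] in
/-- **Transport of Whittaker functionals**: `Λ ∘ ρ(t₀)` is a `ψ_{2L}`-Whittaker functional for every
`ψ`-Whittaker functional `Λ` (`t₀ u t₀⁻¹` has superdiagonal `ϖ^{-2L} u_{i,i+1}`). [folklore] -/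
theorem comp_gradElem_mem_whittakerFunctionals (hϖ0 : ϖ ≠ 0) (L : ℤ) {Λ : Module.Dual ℂ V}
    (hΛ : Λ ∈ whittakerFunctionals ρ ψ) :
    Λ ∘ₗ (ρ (zpowDiagGL hϖ0 (gradExp n L))) ∈ whittakerFunctionals ρ (ψ.mulShift (ϖ ^ (-(2 * L)))) := by
  rw [mem_whittakerFunctionals_iff]
  intro u v
  obtain ⟨hu', hsd⟩ := gradElem_conj_unitriangular hϖ0 L u
  have key := (mem_whittakerFunctionals_iff Λ).1 hΛ ⟨_, hu'⟩ (ρ (zpowDiagGL hϖ0 (gradExp n L)) v)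
  rw [LinearMap.comp_apply, LinearMap.comp_apply]
  have e1 : ρ (zpowDiagGL hϖ0 (gradExp n L)) (ρ (u : GL (Fin n) F) v) =
      ρ (zpowDiagGL hϖ0 (gradExp n L) * (u : GL (Fin n) F) * (zpowDiagGL hϖ0 (gradExp n L))⁻¹)
        (ρ (zpowDiagGL hϖ0 (gradExp n L)) v) := by
    rw [← Module.End.mul_apply, ← map_mul, ← Module.End.mul_apply, ← map_mul]
    congr 2; group
  rw [e1, show ρ (zpowDiagGL hϖ0 (gradExp n L) * (u : GL (Fin n) F) * (zpowDiagGL hϖ0 (gradExp n L))⁻¹) =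
      ρ ((⟨_, hu'⟩ : ↥(upperUnitriangular (Fin n) F)) : GL (Fin n) F) from rfl, key, whittakerCharFun_apply,
    whittakerCharFun_apply, hsd hu', AddChar.mulShift_apply]

/-- **Transport of the uniform projector to the graded one**: for `t₀ = diag(ϖ^{2Li})`,
`ρ(t₀) e^{(t)}_{ϖ^L 𝒪^t, ψ_{2L}(z_{t-1})} w = e^{(t)}_{graded, ψ(z_{t-1})} (ρ(t₀) w)`. [folklore] -/
theorem apply_gradElem_proj [Finite 𝓀[F]] (hϖ : IsUniformizingElement ϖ) (hψ : ∀ c ∈ 𝒪[F], ψ c = 1)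
    {L : ℤ} {t tp : Fin n} (htp : (tp : ℕ) + 1 = t) {a : Fin n → ℤ} {w : V}
    (h : IsAdm ρ ψ ϖ t (cLat n L) a (colCharAt ϖ L t) w) :
    ρ (zpowDiagGL hϖ.ne_zero (gradExp n L)) (proj ρ ψ ϖ t (cLat n L) (colCharAt ϖ L t) w) =
      proj ρ ψ ϖ t (aGr n L t) (Pi.single tp 1) (ρ (zpowDiagGL hϖ.ne_zero (gradExp n L)) w) := by
  rw [apply_zpowDiagGL_proj hϖ hψ (gradExp n L) h, colCharAt_mul_zpow hϖ.ne_zero L htp]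
  rfl

/-- The projector of the column `0` is the identity (the column group is trivial). [folklore] -/
theorem proj_col_zero [Finite 𝓀[F]] (hϖ : IsUniformizingElement ϖ) (hψ : ∀ c ∈ 𝒪[F], ψ c = 1)
    (h0 : 0 < n) {a' a : Fin n → ℤ} {b : Fin n → F} {w : V} (h : IsAdm ρ ψ ϖ ⟨0, h0⟩ a' a b w) :
    proj ρ ψ ϖ ⟨0, h0⟩ a' b w = w := by
  haveI := h.finite hϖ
  letI : Fintype (LQ ϖ ⟨0, h0⟩ a' a) := Fintype.ofFinite _
  have hzero : ∀ z : colLat ϖ (⟨0, h0⟩ : Fin n) a', (z : Fin n → F) = 0 := fun z =>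
    funext fun i => z.2.2 i (by simp [Fin.lt_def])
  have hsub : Subsingleton (LQ ϖ ⟨0, h0⟩ a' a) := by
    refine ⟨fun q q' => ?_⟩
    rw [← QuotientAddGroup.out_eq' q, ← QuotientAddGroup.out_eq' q', LQ_mk_eq_mk_iff, hzero, hzero, sub_zero]
    exact AddSubgroup.zero_mem _
  rw [proj_eq_sum hϖ hψ h]
  have hcard : Fintype.card (LQ ϖ ⟨0, h0⟩ a' a) = 1 := by
    rw [Fintype.card_eq_one_iff]
    exact ⟨QuotientAddGroup.mk 0, fun q => Subsingleton.elim _ _⟩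
  obtain ⟨q₀, hq₀⟩ := Fintype.card_eq_one_iff.1 hcard
  rw [hcard, Nat.cast_one, inv_one, one_smul, Fintype.sum_eq_single q₀ fun q hq => absurd (hq₀ q) hq, hzero,
    neg_zero, colElem_zero, map_one, Module.End.one_apply, cpair_apply, dotProduct_zero, AddChar.map_zero_eq_one,
    Circle.coe_one, one_smul]

/-! ### The canonical iterated column average -/

variable (ρ ψ ϖ) in
/-- **The canonical iterated uniform column average** `colIter L s y = e^{(s-1)} ⋯ e^{(1)} e^{(0)} y`,
`e^{(t)} = e^{(t)}_{ϖ^L 𝒪^t, ψ_{2L}(z_{t-1})}` the canonical twisted projector (so that no choice of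
representatives enters; `colIter_eq_iterAvg`). [folklore] -/
def colIter (L : ℤ) : ℕ → V → V
  | 0 => id
  | s + 1 => fun y =>
      if h : s < n then proj ρ ψ ϖ ⟨s, h⟩ (cLat n L) (colCharAt ϖ L ⟨s, h⟩) (colIter L s y) else colIter L s y

/-- `colIter 0 = id`. [folklore] -/
@[simp] theorem colIter_zero (L : ℤ) (y : V) : colIter ρ ψ ϖ L 0 y = y := rfl

/-- The recursion for `s < n`. [folklore] -/
theorem colIter_succ_of_lt (L : ℤ) {s : ℕ} (h : s < n) (y : V) :
    colIter ρ ψ ϖ L (s + 1) y = proj ρ ψ ϖ ⟨s, h⟩ (cLat n L) (colCharAt ϖ L ⟨s, h⟩) (colIter ρ ψ ϖ L s y) := by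
  simp only [colIter, dif_pos h]

/-- The recursion stops at `s ≥ n`. [folklore] -/
theorem colIter_succ_of_le (L : ℤ) {s : ℕ} (h : n ≤ s) (y : V) :
    colIter ρ ψ ϖ L (s + 1) y = colIter ρ ψ ϖ L s y := by
  simp only [colIter, dif_neg (not_lt.2 h)]

/-- `colIter s = colIter n` for `s ≥ n`. [folklore] -/
theorem colIter_of_le (L : ℤ) {s : ℕ} (h : n ≤ s) (y : V) : colIter ρ ψ ϖ L s y = colIter ρ ψ ϖ L n y := by
  induction s, h using Nat.le_induction with
  | base => rfl
  | succ s hs ih => rw [colIter_succ_of_le L hs, ih]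

/-- **The canonical average is the explicit one**: `colIter L s y = iterAvg s y` for every admissible system
of representatives. [folklore] -/
theorem colIter_eq_iterAvg [Finite 𝓀[F]] (hϖ : IsUniformizingElement ϖ) (hψ : ∀ c ∈ 𝒪[F], ψ c = 1)
    {L L₀ : ℤ} (hL : 1 ≤ L) (h2L : 2 * L ≤ L₀) {R : Fin n → Finset (Fin n → F)}
    (hR : ∀ t, ∀ z ∈ R t, z ∈ colLat ϖ t (cLat n L))
    (hRsep : ∀ t, ∀ z ∈ R t, ∀ z' ∈ R t, z' - z ∈ colLat ϖ t (cLat n L₀) → z = z')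
    (hRcov : ∀ t, ∀ w ∈ colLat ϖ t (cLat n L), ∃ z ∈ R t, w - z ∈ colLat ϖ t (cLat n L₀))
    {y : V} (hy0 : ∀ g ∈ congruenceGL n (valuation F (ϖ ^ L₀)), ρ g y = y) :
    ∀ s, colIter ρ ψ ϖ L s y = iterAvg ϖ L R ρ ψ s y
  | 0 => by rw [colIter_zero, iterAvg_zero]
  | s + 1 => by
    rcases lt_or_ge s n with hs | hs
    · rw [colIter_succ_of_lt L hs, colIter_eq_iterAvg hϖ hψ hL h2L hR hRsep hRcov hy0 s,
        proj_iterAvg hϖ hψ hL h2L hR hRsep hRcov hy0 hs]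
    · rw [colIter_succ_of_le L hs, colIter_eq_iterAvg hϖ hψ hL h2L hR hRsep hRcov hy0 s, iterAvg,
        iterAvg, iterReps_succ_of_le hs]

/-- **Systems of representatives exist** (`Quotient.out` on the finite quotients
`ϖ^L 𝒪^t / ϖ^{L₀} 𝒪^t`). [folklore] -/
theorem exists_reps [Finite 𝓀[F]] (hϖ : IsUniformizingElement ϖ) {L L₀ : ℤ} (hLL₀ : L ≤ L₀) :
    ∃ R : Fin n → Finset (Fin n → F),
      (∀ t, ∀ z ∈ R t, z ∈ colLat ϖ t (cLat n L)) ∧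
      (∀ t, ∀ z ∈ R t, ∀ z' ∈ R t, z' - z ∈ colLat ϖ t (cLat n L₀) → z = z') ∧
      (∀ t, ∀ w ∈ colLat ϖ t (cLat n L), ∃ z ∈ R t, w - z ∈ colLat ϖ t (cLat n L₀)) := by
  have hfin : ∀ t : Fin n, Finite (LQ ϖ t (cLat n L) (cLat n L₀)) := fun t =>
    finite_colLat_quotient hϖ t fun _ _ => hLL₀
  letI : ∀ t : Fin n, Fintype (LQ ϖ t (cLat n L) (cLat n L₀)) := fun t => Fintype.ofFinite _
  refine ⟨fun t => Finset.univ.image fun q : LQ ϖ t (cLat n L) (cLat n L₀) =>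
    ((q.out : colLat ϖ t (cLat n L)) : Fin n → F), fun t z hz => ?_, fun t z hz z' hz' hzz' => ?_, fun t w hw => ?_⟩
  · obtain ⟨q, -, rfl⟩ := Finset.mem_image.1 hz
    exact (q.out).2
  · obtain ⟨q, -, rfl⟩ := Finset.mem_image.1 hz
    obtain ⟨q', -, rfl⟩ := Finset.mem_image.1 hz'
    have : q = q' := by
      rw [← QuotientAddGroup.out_eq' q, ← QuotientAddGroup.out_eq' q']
      exact (LQ_mk_eq_mk_iff _ _).2 hzz'
    rw [this]
  · set q : LQ ϖ t (cLat n L) (cLat n L₀) := QuotientAddGroup.mk (⟨w, hw⟩ : colLat ϖ t (cLat n L)) with hq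
    refine ⟨((q.out : colLat ϖ t (cLat n L)) : Fin n → F), Finset.mem_image.2 ⟨q, Finset.mem_univ _, rfl⟩, ?_⟩
    have h := QuotientAddGroup.out_eq' q
    rw [hq] at h
    exact (LQ_mk_eq_mk_iff _ _).1 h

/-- **Admissibility** of the small lattice `ϖ^{L₀} 𝒪^t` for the column-`t` average of `colIter L s y`.
[folklore] -/
theorem isAdm_colIter [Finite 𝓀[F]] (hϖ : IsUniformizingElement ϖ) (hψ : ∀ c ∈ 𝒪[F], ψ c = 1)
    {L L₀ : ℤ} (hL : 1 ≤ L) (h2L : 2 * L ≤ L₀)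
    {y : V} (hy0 : ∀ g ∈ congruenceGL n (valuation F (ϖ ^ L₀)), ρ g y = y) (s : ℕ) (t : Fin n) :
    IsAdm ρ ψ ϖ t (cLat n L) (cLat n L₀) (colCharAt ϖ L t) (colIter ρ ψ ϖ L s y) := by
  obtain ⟨R, hR, hRsep, hRcov⟩ := exists_reps (n := n) hϖ (show L ≤ L₀ by omega)
  rw [colIter_eq_iterAvg hϖ hψ hL h2L hR hRsep hRcov hy0 s]
  exact isAdm_iterAvg hϖ hL h2L hR hy0 s t

/-- **Whittaker functionals see through the canonical average**: `Λ(colIter L s y) = Λ(y)` for every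
`ψ_{2L}`-Whittaker functional. [folklore] -/
theorem whittaker_colIter [Finite 𝓀[F]] (hϖ : IsUniformizingElement ϖ) (hψ : ∀ c ∈ 𝒪[F], ψ c = 1)
    {L L₀ : ℤ} (hL : 1 ≤ L) (h2L : 2 * L ≤ L₀)
    {y : V} (hy0 : ∀ g ∈ congruenceGL n (valuation F (ϖ ^ L₀)), ρ g y = y) (s : ℕ) {Λ : Module.Dual ℂ V}
    (hΛ : Λ ∈ whittakerFunctionals ρ (ψ.mulShift (ϖ ^ (-(2 * L))))) : Λ (colIter ρ ψ ϖ L s y) = Λ y := by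
  obtain ⟨R, hR, hRsep, hRcov⟩ := exists_reps (n := n) hϖ (show L ≤ L₀ by omega)
  rw [colIter_eq_iterAvg hϖ hψ hL h2L hR hRsep hRcov hy0 s]
  exact whittaker_iterAvg hϖ hL hR hRcov s y hΛ

/-! ### Compactness of the lower triangular part of a truncated congruence subgroup -/

section Local

variable [TopologicalSpace F] [IsNonarchimedeanLocalField F]

/-- The lower triangular part `K_γ^{(s)} ∩ B⁻` of a truncated principal congruence subgroup is compact
(closed in the compact `K_γ`). [folklore] -/
theorem isCompact_congruenceTL_inf_lower (γ : ValueGroupWithZero F) (s : ℕ) :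
    IsCompact ((congruenceTL F n γ s ⊓ oppositeParabolicGL F (id : Fin n → Fin n) :
      Subgroup (GL (Fin n) F)) : Set (GL (Fin n) F)) := by
  haveI : T2Space F := (GaloisRepresentations.IsNonarchimedeanLocalField.isLocalField F).toT2Space
  have hcont : ∀ r c : Fin n, Continuous fun g : GL (Fin n) F => (g : Matrix (Fin n) (Fin n) F) r c :=
    fun r c => Units.continuous_val.matrix_elem r c
  have h1 : IsClosed {g : GL (Fin n) F | IsTopLeftNat s (g : Matrix (Fin n) (Fin n) F)} := by
    have : {g : GL (Fin n) F | IsTopLeftNat s (g : Matrix (Fin n) (Fin n) F)} = ⋂ r : Fin n, ⋂ c : Fin n,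
        {g : GL (Fin n) F | (s ≤ (r : ℕ) ∨ s ≤ (c : ℕ)) → (g : Matrix (Fin n) (Fin n) F) r c = if r = c then 1 else 0} := by
      ext g; simp only [Set.mem_setOf_eq, Set.mem_iInter, IsTopLeftNat]
    rw [this]
    refine isClosed_iInter fun r => isClosed_iInter fun c => ?_
    by_cases hrc : s ≤ (r : ℕ) ∨ s ≤ (c : ℕ)
    · have : {g : GL (Fin n) F | (s ≤ (r : ℕ) ∨ s ≤ (c : ℕ)) → (g : Matrix (Fin n) (Fin n) F) r c = if r = c then 1 else 0} =
          {g : GL (Fin n) F | (g : Matrix (Fin n) (Fin n) F) r c = if r = c then 1 else 0} := by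
        ext g; simp only [Set.mem_setOf_eq]; exact ⟨fun h => h hrc, fun h _ => h⟩
      rw [this]; exact isClosed_eq (hcont r c) continuous_const
    · have : {g : GL (Fin n) F | (s ≤ (r : ℕ) ∨ s ≤ (c : ℕ)) → (g : Matrix (Fin n) (Fin n) F) r c = if r = c then 1 else 0} =
          Set.univ := by
        ext g; simp only [Set.mem_setOf_eq, Set.mem_univ, iff_true]; exact fun h => absurd h hrc
      rw [this]; exact isClosed_univ
  have h2 : IsClosed {g : GL (Fin n) F | g ∈ oppositeParabolicGL F (id : Fin n → Fin n)} := by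
    have : {g : GL (Fin n) F | g ∈ oppositeParabolicGL F (id : Fin n → Fin n)} = ⋂ i : Fin n, ⋂ j : Fin n,
        {g : GL (Fin n) F | i < j → (g : Matrix (Fin n) (Fin n) F) i j = 0} := by
      ext g; simp only [Set.mem_setOf_eq, Set.mem_iInter, mem_oppositeParabolicGL_iff, id]
    rw [this]
    refine isClosed_iInter fun i => isClosed_iInter fun j => ?_
    by_cases hij : i < j
    · have : {g : GL (Fin n) F | i < j → (g : Matrix (Fin n) (Fin n) F) i j = 0} =
          {g : GL (Fin n) F | (g : Matrix (Fin n) (Fin n) F) i j = 0} := by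
        ext g; simp only [Set.mem_setOf_eq]; exact ⟨fun h => h hij, fun h _ => h⟩
      rw [this]; exact isClosed_eq (hcont i j) continuous_const
    · have : {g : GL (Fin n) F | i < j → (g : Matrix (Fin n) (Fin n) F) i j = 0} = Set.univ := by
        ext g; simp only [Set.mem_setOf_eq, Set.mem_univ, iff_true]; exact fun h => absurd h hij
      rw [this]; exact isClosed_univ
  have hset : ((congruenceTL F n γ s ⊓ oppositeParabolicGL F (id : Fin n → Fin n) : Subgroup (GL (Fin n) F)) :
      Set (GL (Fin n) F)) = (congruenceGL n γ : Set (GL (Fin n) F)) ∩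
        ({g : GL (Fin n) F | IsTopLeftNat s (g : Matrix (Fin n) (Fin n) F)} ∩
          {g : GL (Fin n) F | g ∈ oppositeParabolicGL F (id : Fin n → Fin n)}) := by
    ext g
    simp only [Subgroup.coe_inf, Set.mem_inter_iff, SetLike.mem_coe, Set.mem_setOf_eq, mem_topLeftGL_iff, and_assoc]
  rw [hset]
  exact (isCompact_congruenceGL γ).inter_right (h1.inter h2)

/-- **Transversals of the lower triangular part exist**: `K_γ^{(s)} ∩ B⁻` modulo `K_{γ₀}` (`γ₀ ≠ 0`) has a
finite left transversal. [folklore] -/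
theorem exists_lower_transversal (γ : ValueGroupWithZero F) {γ₀ : ValueGroupWithZero F} (hγ₀ : γ₀ ≠ 0) (s : ℕ) :
    ∃ R_B : Finset (GL (Fin n) F),
      IsLeftTransversal (congruenceTL F n γ s ⊓ oppositeParabolicGL F (id : Fin n → Fin n))
        ((congruenceTL F n γ s ⊓ oppositeParabolicGL F (id : Fin n → Fin n)) ⊓ congruenceGL n γ₀) R_B :=
  exists_isLeftTransversal (isCompact_congruenceTL_inf_lower γ s) (isOpen_congruenceGL hγ₀)

/-! ### The canonical average: level, lower invariance, Whittaker transparency -/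

variable (hϖ : IsUniformizingElement ϖ) (hψ : ∀ c ∈ 𝒪[F], ψ c = 1) {L L₀ : ℤ} (hL : 1 ≤ L) (h2L : 2 * L ≤ L₀)
  {y : V} (hy0 : ∀ g ∈ congruenceGL n (valuation F (ϖ ^ L₀)), ρ g y = y)
  (hlow : ∀ b ∈ congruenceGL n (valuation F (ϖ ^ L)), b ∈ oppositeParabolicGL F (id : Fin n → Fin n) → ρ b y = y)
include hϖ hψ hL h2L hy0 hlow


/-- **The level of the canonical average**: `colIter L s y` is fixed by `K(2L)^{(s)}`. [folklore] -/
theorem apply_colIter_eq_self (s : ℕ) {g : GL (Fin n) F}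
    (hg : g ∈ congruenceTL F n (valuation F (ϖ ^ (2 * L))) s) : ρ g (colIter ρ ψ ϖ L s y) = colIter ρ ψ ϖ L s y := by
  obtain ⟨R, hR, hRsep, hRcov⟩ := exists_reps (n := n) hϖ (show L ≤ L₀ by omega)
  have hγ₀ : valuation F (ϖ ^ L₀) ≠ 0 := by
    rw [ne_eq, map_eq_zero]; exact zpow_ne_zero _ hϖ.ne_zero
  obtain ⟨R_B, hB⟩ := exists_lower_transversal (n := n) (valuation F (ϖ ^ L)) hγ₀ s
  rw [colIter_eq_iterAvg hϖ hψ hL h2L hR hRsep hRcov hy0 s]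
  exact apply_iterAvg_eq_self hϖ hψ hL h2L hR hRsep hRcov hy0 s hB
    (fun b hb => hlow b (hB.mem_of_mem b hb).1.1 (hB.mem_of_mem b hb).2) hg

/-- **Lower triangular elements of `K(L)^{(s)}` fix the canonical average.** [folklore] -/
theorem apply_colIter_eq_self_of_lower (s : ℕ) {b : GL (Fin n) F}
    (hb : b ∈ congruenceTL F n (valuation F (ϖ ^ L)) s) (hbl : b ∈ oppositeParabolicGL F (id : Fin n → Fin n)) :
    ρ b (colIter ρ ψ ϖ L s y) = colIter ρ ψ ϖ L s y := by
  obtain ⟨R, hR, hRsep, hRcov⟩ := exists_reps (n := n) hϖ (show L ≤ L₀ by omega)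
  have hγ₀ : valuation F (ϖ ^ L₀) ≠ 0 := by
    rw [ne_eq, map_eq_zero]; exact zpow_ne_zero _ hϖ.ne_zero
  obtain ⟨R_B, hB⟩ := exists_lower_transversal (n := n) (valuation F (ϖ ^ L)) hγ₀ s
  rw [colIter_eq_iterAvg hϖ hψ hL h2L hR hRsep hRcov hy0 s]
  exact apply_iterAvg_eq_self_of_lower hϖ hψ hL h2L hR hRsep hRcov hy0 s hB
    (fun b hb => hlow b (hB.mem_of_mem b hb).1.1 (hB.mem_of_mem b hb).2) hb hbl

/-- **Equivariance** under the whole `K(L)^{(s)}`. [folklore] -/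
theorem apply_colIter (s : ℕ) {g : GL (Fin n) F} (hg : g ∈ congruenceTL F n (valuation F (ϖ ^ L)) s) :
    ρ g (colIter ρ ψ ϖ L s y) = congChar (ψ.mulShift (ϖ ^ (-(2 * L)))) g • colIter ρ ψ ϖ L s y := by
  obtain ⟨R, hR, hRsep, hRcov⟩ := exists_reps (n := n) hϖ (show L ≤ L₀ by omega)
  have hγ₀ : valuation F (ϖ ^ L₀) ≠ 0 := by
    rw [ne_eq, map_eq_zero]; exact zpow_ne_zero _ hϖ.ne_zero
  obtain ⟨R_B, hB⟩ := exists_lower_transversal (n := n) (valuation F (ϖ ^ L)) hγ₀ s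
  rw [colIter_eq_iterAvg hϖ hψ hL h2L hR hRsep hRcov hy0 s]
  exact apply_iterAvg hϖ hψ hL h2L hR hRsep hRcov hy0 s hB
    (fun b hb => hlow b (hB.mem_of_mem b hb).1.1 (hB.mem_of_mem b hb).2) hg

end Local

/-! ### The explicit one-step descent -/

section Step

open Filter
open scoped ComplexConjugate

variable [TopologicalSpace F] [IsNonarchimedeanLocalField F]
  (hϖ : IsUniformizingElement ϖ) (hψ : ∀ c ∈ 𝒪[F], ψ c = 1) (hψ' : ∃ c ∈ 𝒪[F], ψ (ϖ⁻¹ * c) ≠ 1)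
  (hρ : ρ.IsSmooth) {Λ : Module.Dual ℂ V} {Φ : V →ₗ⋆[ℂ] V →ₗ[ℂ] ℂ} {t tp : Fin n} {j : ℕ}
  (hLev : IsLevel ρ ψ hϖ.ne_zero Λ Φ t j) (htp : (tp : ℕ) + 1 = t)
include hϖ hψ hψ' hρ hLev htp

/-- **Controlled thresholds**: if `L_M` (`M ≥ 0`) is admissible for `e_{-N} v`, `e_{-N} w` (`N ≥ 1`) and the
row shears `1 + e_{t-1} ⊗ c`, `c ∈ ϖ^N 𝒪^t`, fix `v` and `w`, then the descended form is already the `N`-th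
approximant: `Φ'(v, w) = q^{Nt} Φ(e_{-N} v, e_{-N} w)` (eventual constancy from `N` on,
`form_proj_proj_eq_card_mul`). [folklore] -/
theorem descendForm_eq_dStep_of {v w : V} {N : ℕ} (hN : 1 ≤ N) {M : ℤ} (hM0 : 0 ≤ M)
    (hAv : IsAdm ρ ψ ϖ t (fun _ => -(N : ℤ)) (fun _ => M) (Pi.single tp 1) v)
    (hAw : IsAdm ρ ψ ϖ t (fun _ => -(N : ℤ)) (fun _ => M) (Pi.single tp 1) w)
    (hfix : ∀ c ∈ colLat ϖ t (fun _ : Fin n => (N : ℤ)), ∀ h : 1 + c tp ≠ 0,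
      ρ (rowShear tp c h) v = v ∧ ρ (rowShear tp c h) w = w) :
    descendForm ρ ψ ϖ Φ t tp v w = dStep ρ ψ ϖ Φ t tp N v w := by
  have hstep : ∀ k : ℕ, dStep ρ ψ ϖ Φ t tp (N + k + 1) v w = dStep ρ ψ ϖ Φ t tp (N + k) v w := by
    intro k
    set N' : ℕ := N + k with hN'
    haveI : Fintype (LQ ϖ t (-fun _ : Fin n => -(N' : ℤ)) (-fun _ : Fin n => -((N' : ℤ) + 1))) :=
      @Fintype.ofFinite _ (finite_colLat_quotient hϖ t fun i _ => by simp)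
    have key := form_proj_proj_eq_card_mul hϖ hψ hψ' hLev htp (a := fun _ => -(N' : ℤ)) (s := -((N' : ℤ) + 1))
      (M := M) (fun _ _ => by omega) (fun _ _ => by simp) (by omega)
      (hAv.of_le fun i hi => le_trans (by omega) (hAv.le i hi)) (hAw.of_le fun i hi => le_trans (by omega) (hAw.le i hi))
      (le_trans (by omega) (hAv.le tp (Fin.lt_def.2 (by omega)))) hM0
      (fun c hc h => hfix c ⟨fun i hi => zBall_anti hϖ.ne_zero hϖ.valuation_le_one (by omega : (N : ℤ) ≤ N')
        (by simpa using hc.1 i hi), fun i hi => hc.2 i hi⟩ h)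
    rw [dStep, dStep, key, card_LQ_succ' hϖ t N', Nat.cast_pow, ← mul_assoc, ← pow_add]
    simp only [Nat.cast_succ, Nat.succ_mul]
  have hconst : ∀ k : ℕ, dStep ρ ψ ϖ Φ t tp (N + k) v w = dStep ρ ψ ϖ Φ t tp N v w := by
    intro k
    induction k with
    | zero => rfl
    | succ k ih => rw [← add_assoc, hstep k, ih]
  obtain ⟨N₀, hN₀⟩ := descendForm_eq₂ hϖ hψ hψ' hρ hLev htp v w v w
  rw [(hN₀ (N + N₀) (Nat.le_add_left _ _)).1, hconst]

omit hϖ hρ hψ hψ' hLev htp in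
omit [TopologicalSpace F] [IsNonarchimedeanLocalField F] in
/-- The exponent bookkeeping of the graded collapse: `∑_{i<t} (N + a_i) + e_t = N t` for the graded
exponents `a = aGr` and `N ≥ -a_i`. [folklore] -/
theorem sum_toNat_add_eGr {L : ℤ} (hL : 0 ≤ L) {N : ℕ} (hNa : ∀ i, i < t → -(N : ℤ) ≤ aGr n L t i) :
    (∑ i : {i : Fin n // i < t}, ((N : ℤ) + aGr n L t i).toNat) + eGr n L t = N * (t : ℕ) := by
  rw [eGr, ← Finset.sum_add_distrib]
  have : ∀ i : {i : Fin n // i < t}, ((N : ℤ) + aGr n L t i).toNat + (-aGr n L t i).toNat = N := by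
    intro i
    have h1 : 0 ≤ (N : ℤ) + aGr n L t i := by have := hNa i i.2; omega
    have h2 : 0 ≤ -aGr n L t i := by have := aGr_le (n := n) hL i.2; omega
    zify [Int.toNat_of_nonneg h1, Int.toNat_of_nonneg h2]
    omega
  rw [Finset.sum_congr rfl fun i _ => this i, Finset.sum_const, Finset.card_univ, card_subtype_lt, smul_eq_mul,
    mul_comm]

/-- **The explicit one-step descent on a graded vector.** If the graded lattice of the column `t`
(exponents `(i - t) 2L + L`) admits a square small lattice `L_{M'}` at `x` and the row shears
`1 + e_{t-1} ⊗ c`, `c_i ∈ ϖ^{(t-i)2L - L} 𝒪`, fix `x`, then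
`Φ'(x, x) = q^{e_t} Φ(e^{gr} x, e^{gr} x)` with `e^{gr}` the graded projector at the standard character and
`e_t = ∑_{i<t} ((t-i) 2L - L)`. [folklore] -/
theorem descendForm_graded {L : ℤ} (hL : 1 ≤ L) {M' : ℤ} (hM'0 : 0 ≤ M') {x : V}
    (hAx : IsAdm ρ ψ ϖ t (aGr n L t) (fun _ => M') (Pi.single tp 1) x)
    (hfix : ∀ c ∈ colLat ϖ t (-aGr n L t), ∀ h : 1 + c tp ≠ 0, ρ (rowShear tp c h) x = x) :
    descendForm ρ ψ ϖ Φ t tp x x = (Nat.card 𝓀[F] : ℂ) ^ eGr n L t *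
      Φ (proj ρ ψ ϖ t (aGr n L t) (Pi.single tp 1) x) (proj ρ ψ ϖ t (aGr n L t) (Pi.single tp 1) x) := by
  -- a square lattice `ϖ^{-N} 𝒪^t` containing the graded one
  obtain ⟨N, hN1, hNa⟩ : ∃ N : ℕ, 1 ≤ N ∧ ∀ i, i < t → -(N : ℤ) ≤ aGr n L t i := by
    refine ⟨((t : ℤ) * (2 * L)).toNat, ?_, fun i hi => ?_⟩
    · have ht1 : (1 : ℤ) ≤ t := by have := htp; omega
      have : (1 : ℤ) ≤ (t : ℤ) * (2 * L) := by nlinarith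
      omega
    · rw [aGr_apply, Int.toNat_of_nonneg (by positivity)]
      have : (0 : ℤ) ≤ i := by positivity
      nlinarith
  have hAN : IsAdm ρ ψ ϖ t (fun _ => -(N : ℤ)) (fun _ => M') (Pi.single tp 1) x :=
    hAx.of_le fun i hi => (hNa i hi).trans (hAx.le i hi)
  have hsub : colLat ϖ t (fun _ : Fin n => (N : ℤ)) ≤ colLat ϖ t (-aGr n L t) :=
    colLat_mono hϖ.ne_zero hϖ.valuation_le_one fun i hi => by have := hNa i hi; simp only [Pi.neg_apply]; omega
  have h1 := descendForm_eq_dStep_of hϖ hψ hψ' hρ hLev htp hN1 hM'0 hAN hAN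
    (fun c hc h => ⟨hfix c (hsub hc) h, hfix c (hsub hc) h⟩)
  -- the collapse of the graded projector onto the square one
  haveI : Fintype (LQ ϖ t (-aGr n L t) (-fun _ : Fin n => -(N : ℤ))) :=
    @Fintype.ofFinite _ (finite_colLat_quotient hϖ t fun i hi => by have := hNa i hi; simp only [Pi.neg_apply]; omega)
  have h2 := form_proj_proj_eq_card_mul hϖ hψ hψ' hLev htp (a := aGr n L t) (s := -(N : ℤ)) (M := M')
    hNa (fun i hi => by have := aGr_le (n := n) (by omega : (0 : ℤ) ≤ L) hi; omega)
    (by have := aGr_le (n := n) (t := t) (i := tp) (by omega : (0 : ℤ) ≤ L) (Fin.lt_def.2 (by omega)); omega)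
    hAx hAx (by have := hAx.le tp (Fin.lt_def.2 (by omega)); have := hNa tp (Fin.lt_def.2 (by omega)); omega) hM'0
    (fun c hc h => ⟨hfix c hc h, hfix c hc h⟩)
  have hcard : (Fintype.card (LQ ϖ t (-aGr n L t) (-fun _ : Fin n => -(N : ℤ))) : ℂ) =
      (Nat.card 𝓀[F] : ℂ) ^ ∑ i : {i : Fin n // i < t}, ((N : ℤ) + aGr n L t i).toNat := by
    rw [← Nat.card_eq_fintype_card,
      show Nat.card (LQ ϖ t (-aGr n L t) (-fun _ : Fin n => -(N : ℤ))) = _ from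
        natCard_colLat_quotient hϖ t (fun i hi => by have := hNa i hi; simp only [Pi.neg_apply]; omega), Nat.cast_pow]
    congr 1
    refine Finset.sum_congr rfl fun i _ => ?_
    simp only [Pi.neg_apply, neg_neg, sub_neg_eq_add]
  have hsum := sum_toNat_add_eGr (t := t) (by omega : (0 : ℤ) ≤ L) hNa
  rw [h1, dStep, ← hsum, pow_add, mul_comm (_ ^ _) (_ ^ eGr n L t), mul_assoc, ← hcard, ← h2]

end Step

/-- **Graded row shears fix the graded averages**: for `c_i ∈ ϖ^{(t-i)2L - L} 𝒪` the row shear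
`1 + e_{t-1} ⊗ c` fixes `ρ(t₀) colIter L t y` (its conjugate is a lower Iwahori element of `K(L)^{(t)}`).
[folklore] -/
theorem apply_rowShear_gradElem_colIter [TopologicalSpace F] [IsNonarchimedeanLocalField F]
    (hϖ : IsUniformizingElement ϖ) (hψ : ∀ c ∈ 𝒪[F], ψ c = 1) {L L₀ : ℤ} (hL : 1 ≤ L) (h2L : 2 * L ≤ L₀)
    {y : V} (hy0 : ∀ g ∈ congruenceGL n (valuation F (ϖ ^ L₀)), ρ g y = y)
    (hlow : ∀ b ∈ congruenceGL n (valuation F (ϖ ^ L)), b ∈ oppositeParabolicGL F (id : Fin n → Fin n) → ρ b y = y)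
    {t tp : Fin n} (htp : (tp : ℕ) + 1 = t) {c : Fin n → F} (hc : c ∈ colLat ϖ t (-aGr n L t)) (h : 1 + c tp ≠ 0) :
    ρ (rowShear tp c h) (ρ (zpowDiagGL hϖ.ne_zero (gradExp n L)) (colIter ρ ψ ϖ L t y)) =
      ρ (zpowDiagGL hϖ.ne_zero (gradExp n L)) (colIter ρ ψ ϖ L t y) := by
  obtain ⟨hvb, htl, hlo⟩ := conj_rowShear_graded hϖ.ne_zero (L := L) htp hc h
  have hγ1 : valuation F (ϖ ^ L) < 1 := valuation_zpow_lt_one hϖ hL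
  have hmem : (zpowDiagGL hϖ.ne_zero (gradExp n L))⁻¹ * rowShear tp c h * zpowDiagGL hϖ.ne_zero (gradExp n L) ∈
      congruenceTL F n (valuation F (ϖ ^ L)) t :=
    ⟨mem_congruenceGL_of_valBound_sub_one hγ1 hvb, mem_topLeftGL_iff.2 htl⟩
  set t₀ := zpowDiagGL hϖ.ne_zero (gradExp n L) with ht₀
  rw [← Module.End.mul_apply, ← map_mul, show rowShear tp c h * t₀ = t₀ * (t₀⁻¹ * rowShear tp c h * t₀) by group,
    map_mul, Module.End.mul_apply, apply_colIter_eq_self_of_lower hϖ hψ hL h2L hy0 hlow (t : ℕ) hmem hlo]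

end General

/-! ### The explicit tower on graded vectors -/

section Tower

open scoped ComplexConjugate

variable [TopologicalSpace F] [IsNonarchimedeanLocalField F] {m : ℕ}
  {V : Type*} [AddCommGroup V] [Module ℂ V]
  {ρ : Representation ℂ (GL (Fin (m + 1)) F) V} {ψ : AddChar F Circle} {ϖ : F}
  (hϖ : IsUniformizingElement ϖ) (hψ : ∀ c ∈ 𝒪[F], ψ c = 1) (hψ' : ∃ c ∈ 𝒪[F], ψ (ϖ⁻¹ * c) ≠ 1)
  (hρ : ρ.IsSmooth) {Λ : Module.Dual ℂ V} {B : V →ₗ⋆[ℂ] V →ₗ[ℂ] ℂ}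
  (hLev : ∀ k, k ≤ m → IsLevel ρ ψ hϖ.ne_zero Λ (levelForm ρ ψ ϖ B k) (col m k) k)
  {L L₀ : ℤ} (hL : 1 ≤ L) (h2L : 2 * L ≤ L₀)
  {y : V} (hy0 : ∀ g ∈ congruenceGL (m + 1) (valuation F (ϖ ^ L₀)), ρ g y = y)
  (hlow : ∀ b ∈ congruenceGL (m + 1) (valuation F (ϖ ^ L)), b ∈ oppositeParabolicGL F (id : Fin (m + 1) → Fin (m + 1)) →
    ρ b y = y)

/-- The **total descent exponent** below the level `k`: `E_k = ∑_{k ≤ k' < m} e_{m - k'}`. [folklore] -/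
def eTot (m : ℕ) (L : ℤ) (k : ℕ) : ℕ := ∑ k' ∈ Finset.Ico k m, eGr (m + 1) L (col m k')

include hϖ hψ hL h2L hy0 in
/-- **The graded recursion**: `ρ(t₀) colIter L (t+1) y = e^{gr}_t (ρ(t₀) colIter L t y)`. [folklore] -/
theorem gradElem_colIter_succ {t tp : Fin (m + 1)} (htp : (tp : ℕ) + 1 = t) :
    ρ (zpowDiagGL hϖ.ne_zero (gradExp (m + 1) L)) (colIter ρ ψ ϖ L ((t : ℕ) + 1) y) =
      proj ρ ψ ϖ t (aGr (m + 1) L t) (Pi.single tp 1)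
        (ρ (zpowDiagGL hϖ.ne_zero (gradExp (m + 1) L)) (colIter ρ ψ ϖ L (t : ℕ) y)) := by
  have heta : (⟨(t : ℕ), t.2⟩ : Fin (m + 1)) = t := Fin.ext rfl
  rw [colIter_succ_of_lt L t.2, heta, apply_gradElem_proj hϖ hψ htp (isAdm_colIter hϖ hψ hL h2L hy0 (t : ℕ) t)]

include hϖ hψ hψ' hρ hLev hL h2L hy0 hlow in
/-- **The explicit tower**: for every level `k ≤ m`,
`Φ_m(ρ(t₀) y, ρ(t₀) y) = q^{E_k} Φ_k(ρ(t₀) colIter L (m-k+1) y, ρ(t₀) colIter L (m-k+1) y)`. [folklore] -/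
theorem levelForm_graded_eq_of_le {k : ℕ} (hk : k ≤ m) :
    (levelForm ρ ψ ϖ B m) (ρ (zpowDiagGL hϖ.ne_zero (gradExp (m + 1) L)) (colIter ρ ψ ϖ L 1 y))
        (ρ (zpowDiagGL hϖ.ne_zero (gradExp (m + 1) L)) (colIter ρ ψ ϖ L 1 y)) =
      (Nat.card 𝓀[F] : ℂ) ^ eTot m L k *
        (levelForm ρ ψ ϖ B k) (ρ (zpowDiagGL hϖ.ne_zero (gradExp (m + 1) L)) (colIter ρ ψ ϖ L (m - k + 1) y))
          (ρ (zpowDiagGL hϖ.ne_zero (gradExp (m + 1) L)) (colIter ρ ψ ϖ L (m - k + 1) y)) := by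
  induction hk using Nat.decreasingInduction with
  | self => rw [eTot, Finset.Ico_self, Finset.sum_empty, pow_zero, one_mul, Nat.sub_self]
  | of_succ k hk ih =>
    -- descend from the level `k + 1` (column `m - k`, value `t`) to the level `k`
    rw [ih, eTot, eTot, Finset.sum_eq_sum_Ico_succ_bot (by omega : k < m), pow_add,
      mul_comm (_ ^ eGr (m + 1) L (col m k)) (_ ^ _), mul_assoc]
    congr 1
    set t : Fin (m + 1) := col m k with ht
    set tp : Fin (m + 1) := col m (k + 1) with htp'
    have htp : (tp : ℕ) + 1 = t := by simp only [ht, htp', col_val]; omega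
    have hidx : m - (k + 1) + 1 = (t : ℕ) := by simp only [ht, col_val]; omega
    have hidx' : m - k + 1 = (t : ℕ) + 1 := by simp only [ht, col_val]
    rw [levelForm_succ, hidx, hidx', gradElem_colIter_succ hϖ hψ hL h2L hy0 htp]
    -- the explicit one-step descent at the level `k`
    have hL0 : (0 : ℤ) ≤ L₀ := by omega
    have hA := (isAdm_colIter hϖ hψ hL h2L hy0 (t : ℕ) t).conj_zpowDiagGL hϖ (gradExp (m + 1) L)
    rw [colCharAt_mul_zpow hϖ.ne_zero L htp] at hA
    have hA' : IsAdm ρ ψ ϖ t (aGr (m + 1) L t) (fun _ => L₀) (Pi.single tp 1)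
        (ρ (zpowDiagGL hϖ.ne_zero (gradExp (m + 1) L)) (colIter ρ ψ ϖ L (t : ℕ) y)) :=
      hA.mono hϖ.ne_zero hϖ.valuation_le_one fun i hi => by
        simp only [gradExp_apply, cLat_apply]
        have := Fin.lt_def.1 hi
        nlinarith
    exact descendForm_graded hϖ hψ hψ' hρ (hLev k (by omega)) htp hL hL0 hA'
      (fun c hc h => apply_rowShear_gradElem_colIter hϖ hψ hL h2L hy0 hlow htp hc h)

include hϖ hψ hψ' hρ hLev hL h2L hy0 hlow in
/-- **The explicit descent formula**: `Φ_m(ρ(t₀) y, ρ(t₀) y) = q^{E_0} B(z, z)` with `z = colIter L (m+1) y` the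
full canonical iterated column average of `y` (`B` invariant). [folklore] -/
theorem levelForm_graded_eq (hBi : ∀ (g : GL (Fin (m + 1)) F) (v w : V), B (ρ g v) (ρ g w) = B v w)
    (h0 : colIter ρ ψ ϖ L 1 y = y) :
    (levelForm ρ ψ ϖ B m) (ρ (zpowDiagGL hϖ.ne_zero (gradExp (m + 1) L)) y)
        (ρ (zpowDiagGL hϖ.ne_zero (gradExp (m + 1) L)) y) =
      (Nat.card 𝓀[F] : ℂ) ^ eTot m L 0 * B (colIter ρ ψ ϖ L (m + 1) y) (colIter ρ ψ ϖ L (m + 1) y) := by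
  have := levelForm_graded_eq_of_le hϖ hψ hψ' hρ hLev hL h2L hy0 hlow (Nat.zero_le m)
  rw [h0] at this
  rw [this, Nat.sub_zero, show levelForm ρ ψ ϖ B 0 = B from rfl, hBi]

include hϖ hψ hL h2L hy0 in
/-- `colIter L 1 y = y` (the column `0` is trivial). [folklore] -/
theorem colIter_one : colIter ρ ψ ϖ L 1 y = y := by
  rw [colIter_succ_of_lt L (Nat.succ_pos m)]
  exact proj_col_zero hϖ hψ (Nat.succ_pos m) (isAdm_colIter hϖ hψ hL h2L hy0 0 ⟨0, Nat.succ_pos m⟩)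

include hϖ hψ hψ' hρ hLev hL h2L hy0 hlow in
/-- **The pointwise bound**: with a bound `|Λ w|² ≤ C · B(w, w)` on the vectors `w` of level `K(ϖ^{2L(m+1)})`,
`|Λ(ρ(t₀) y)|² ≤ C q^{-E_0} Φ_m(ρ(t₀) y, ρ(t₀) y)`. [folklore] -/
theorem norm_sq_whittaker_graded_le (hΛ : Λ ∈ whittakerFunctionals ρ ψ)
    (hBi : ∀ (g : GL (Fin (m + 1)) F) (v w : V), B (ρ g v) (ρ g w) = B v w) {C : ℝ}
    (hC : ∀ w : V, (∀ g ∈ congruenceGL (m + 1) (valuation F (ϖ ^ (2 * L * (m + 1 : ℕ)))), ρ g w = w) →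
      ‖Λ w‖ ^ 2 ≤ C * (B w w).re) :
    ‖Λ (ρ (zpowDiagGL hϖ.ne_zero (gradExp (m + 1) L)) y)‖ ^ 2 ≤
      C * ((Nat.card 𝓀[F] : ℝ))⁻¹ ^ eTot m L 0 *
        ((levelForm ρ ψ ϖ B m) (ρ (zpowDiagGL hϖ.ne_zero (gradExp (m + 1) L)) y)
          (ρ (zpowDiagGL hϖ.ne_zero (gradExp (m + 1) L)) y)).re := by
  have h0 := colIter_one hϖ hψ hL h2L hy0
  -- `Λ(ρ(t₀) y) = Λ(ρ(t₀) z)`, `z = colIter L (m+1) y`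
  have hΛ' := comp_gradElem_mem_whittakerFunctionals (ρ := ρ) (ψ := ψ) hϖ.ne_zero L hΛ
  have h1 : Λ (ρ (zpowDiagGL hϖ.ne_zero (gradExp (m + 1) L)) y) =
      Λ (ρ (zpowDiagGL hϖ.ne_zero (gradExp (m + 1) L)) (colIter ρ ψ ϖ L (m + 1) y)) := by
    have := whittaker_colIter hϖ hψ hL h2L hy0 (m + 1) hΛ'
    rw [LinearMap.comp_apply, LinearMap.comp_apply] at this
    rw [this]
  -- `ρ(t₀) z` has level `K(ϖ^{2L(m+1)})`
  have h2 : ∀ g ∈ congruenceGL (m + 1) (valuation F (ϖ ^ (2 * L * (m + 1 : ℕ)))),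
      ρ g (ρ (zpowDiagGL hϖ.ne_zero (gradExp (m + 1) L)) (colIter ρ ψ ϖ L (m + 1) y)) =
        ρ (zpowDiagGL hϖ.ne_zero (gradExp (m + 1) L)) (colIter ρ ψ ϖ L (m + 1) y) := by
    intro g hg
    have hk := conj_gradElem_mem_congruenceGL hϖ hL hg
    rw [← Module.End.mul_apply, ← map_mul,
      show g * zpowDiagGL hϖ.ne_zero (gradExp (m + 1) L) = zpowDiagGL hϖ.ne_zero (gradExp (m + 1) L) *
        ((zpowDiagGL hϖ.ne_zero (gradExp (m + 1) L))⁻¹ * g * zpowDiagGL hϖ.ne_zero (gradExp (m + 1) L)) by group,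
      map_mul, Module.End.mul_apply,
      apply_colIter_eq_self hϖ hψ hL h2L hy0 hlow (m + 1) ⟨hk, by rw [topLeftGL_eq_top le_rfl]; trivial⟩]
  have h3 := hC _ h2
  rw [hBi] at h3
  have h4 := levelForm_graded_eq hϖ hψ hψ' hρ hLev hL h2L hy0 hlow hBi h0
  rw [h1]
  refine h3.trans (le_of_eq ?_)
  rw [h4, ← Complex.ofReal_natCast, ← Complex.ofReal_pow, Complex.re_ofReal_mul, mul_assoc]
  congr 1
  rw [← mul_assoc, ← mul_pow, inv_mul_cancel₀ (Nat.cast_ne_zero.2 Nat.card_pos.ne'), one_pow, one_mul]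

omit [TopologicalSpace F] [IsNonarchimedeanLocalField F] in
include hϖ in
/-- **Near-antitone torus elements keep the lower Iwahori invariance**: for `v` fixed by `K(ℓ)`, `λ` with
`λ_j ≤ λ_i + (j - i) ℓ` (`i ≤ j`), units `μ` and `L ≥ ℓ`, every lower triangular `b ∈ K(L)` fixes
`ρ(t₀⁻¹ ϖ^λ D_μ) v` (its conjugate lies in `K(ℓ)`). [folklore] -/
theorem apply_lower_torus_eq_self {ℓ : ℕ} (hℓ : 1 ≤ ℓ) (hLℓ : (ℓ : ℤ) ≤ L) {v : V}
    (hv : ∀ g ∈ congruenceGL (m + 1) (valuation F (ϖ ^ (ℓ : ℤ))), ρ g v = v)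
    {la : Fin (m + 1) → ℤ} (hla : ∀ i j : Fin (m + 1), i ≤ j → la j ≤ la i + ((j : ℤ) - i) * ℓ)
    {mu : Fin (m + 1) → Fˣ} (hmu : ∀ i, valuation F (mu i : F) = 1)
    {b : GL (Fin (m + 1)) F} (hb : b ∈ congruenceGL (m + 1) (valuation F (ϖ ^ L)))
    (hbl : b ∈ oppositeParabolicGL F (id : Fin (m + 1) → Fin (m + 1))) :
    ρ b (ρ ((zpowDiagGL hϖ.ne_zero (gradExp (m + 1) L))⁻¹ * torusElem hϖ.ne_zero la mu) v) =
      ρ ((zpowDiagGL hϖ.ne_zero (gradExp (m + 1) L))⁻¹ * torusElem hϖ.ne_zero la mu) v := by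
  set w : Fin (m + 1) → Fˣ := fun i => (Units.mk0 ϖ hϖ.ne_zero ^ gradExp (m + 1) L i)⁻¹ * (Units.mk0 ϖ hϖ.ne_zero ^ la i * mu i)
    with hw
  have hd : (zpowDiagGL hϖ.ne_zero (gradExp (m + 1) L))⁻¹ * torusElem hϖ.ne_zero la mu = diagonalGL (Fin (m + 1)) F w := by
    rw [torusElem, zpowDiagGL_eq_diagonalGL, zpowDiagGL_eq_diagonalGL, ← map_inv, ← map_mul, ← map_mul]; rfl
  have hwval : ∀ i, valuation F (w i : F) = valuation F (ϖ ^ (la i - gradExp (m + 1) L i)) := by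
    intro i
    simp only [hw, Units.val_mul, Units.val_inv_eq_inv_val, Units.val_zpow_eq_zpow_val, Units.val_mk0, map_mul, map_inv₀,
      hmu i, mul_one]
    rw [zpow_sub₀ hϖ.ne_zero, map_div₀, div_eq_inv_mul]
  have hγ1 : valuation F (ϖ ^ (ℓ : ℤ)) < 1 := by
    rw [zpow_natCast, map_pow]; exact pow_lt_one' hϖ.valuation_lt_one (by omega)
  have hmem : (diagonalGL (Fin (m + 1)) F w)⁻¹ * b * diagonalGL (Fin (m + 1)) F w ∈
      congruenceGL (m + 1) (valuation F (ϖ ^ (ℓ : ℤ))) := by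
    refine mem_congruenceGL_of_valBound_sub_one hγ1 fun r c => ?_
    have hent : ((((diagonalGL (Fin (m + 1)) F w)⁻¹ * b * diagonalGL (Fin (m + 1)) F w : GL (Fin (m + 1)) F) :
        Matrix (Fin (m + 1)) (Fin (m + 1)) F) - 1) r c =
          ((w r : F))⁻¹ * (((b : GL (Fin (m + 1)) F) : Matrix (Fin (m + 1)) (Fin (m + 1)) F) - 1) r c * (w c : F) := by
      rw [Matrix.sub_apply, coe_diagonalGL_inv_mul_mul_apply, Matrix.sub_apply, mul_sub, sub_mul, Matrix.one_apply]
      split_ifs with hrc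
      · subst hrc; rw [mul_one, inv_mul_cancel₀ (Units.ne_zero _)]
      · rw [mul_zero, zero_mul]
    rw [hent]
    rcases lt_or_ge r c with hrc | hrc
    · rw [Matrix.sub_apply, (mem_oppositeParabolicGL_iff b).1 hbl r c hrc, Matrix.one_apply_ne (ne_of_lt hrc), sub_zero,
        mul_zero, zero_mul, map_zero]
      exact zero_le
    · rw [map_mul, map_mul, map_inv₀, hwval, hwval]
      have hbrc := hb.2.1 r c
      calc (valuation F (ϖ ^ (la r - gradExp (m + 1) L r)))⁻¹ *
            valuation F ((((b : GL (Fin (m + 1)) F) : Matrix (Fin (m + 1)) (Fin (m + 1)) F) - 1) r c) *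
            valuation F (ϖ ^ (la c - gradExp (m + 1) L c))
          ≤ (valuation F (ϖ ^ (la r - gradExp (m + 1) L r)))⁻¹ * valuation F (ϖ ^ L) *
            valuation F (ϖ ^ (la c - gradExp (m + 1) L c)) := by gcongr
        _ = valuation F (ϖ ^ (-(la r - gradExp (m + 1) L r) + L + (la c - gradExp (m + 1) L c))) := by
            rw [zpow_add₀ hϖ.ne_zero, zpow_add₀ hϖ.ne_zero, map_mul, map_mul, _root_.zpow_neg, map_inv₀]
        _ ≤ valuation F (ϖ ^ (ℓ : ℤ)) := valuation_zpow_le_of_le hϖ.ne_zero hϖ.valuation_le_one (by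
            simp only [gradExp_apply]
            have h1 := hla c r hrc
            have h2 : ((c : ℕ) : ℤ) ≤ r := by exact_mod_cast (Fin.le_def.1 hrc)
            nlinarith)
  rw [hd, ← Module.End.mul_apply, ← map_mul,
    show b * diagonalGL (Fin (m + 1)) F w = diagonalGL (Fin (m + 1)) F w * ((diagonalGL (Fin (m + 1)) F w)⁻¹ * b *
      diagonalGL (Fin (m + 1)) F w) by group, map_mul, Module.End.mul_apply, hv _ hmem]

include hϖ hψ hψ' hρ hLev in
/-- **The Kirillov `L²`-bound on a near-antitone torus window.** Let `v` be fixed by `K(ℓ)` (`ℓ ≥ 1`),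
`L ≥ ℓ`, `U` a set of units pairwise incongruent modulo `ϖ^ℓ`, and suppose `|Λ w|² ≤ C · B(w, w)` for all
`w` of level `K(ϖ^{2L(m+1)})`. Then for every finite set `T` of pairs `(λ, μ)` with `λ_m = 0`, `μ_m = 1`,
`μ_i ∈ U` (`i < m`) and `λ_j ≤ λ_i + (j - i) ℓ` (`i ≤ j`),
`∑_{(λ,μ) ∈ T} q^{w(λ)} |Λ(ρ(ϖ^λ D_μ) v)|² ≤ C q^{ℓ m(m+1)/2} q^{-E_0} B(v, v)`
(`bessel_bound_level` and `norm_sq_whittaker_graded_le`). [cite: JacquetShalikaAJM1981, §1] -/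
theorem sum_norm_sq_whittaker_le (hΛ : Λ ∈ whittakerFunctionals ρ ψ)
    (hBi : ∀ (g : GL (Fin (m + 1)) F) (v w : V), B (ρ g v) (ρ g w) = B v w)
    {ℓ : ℕ} (hℓ : 1 ≤ ℓ) (hLℓ : (ℓ : ℤ) ≤ L) {U : Finset Fˣ} (hU1 : ∀ u ∈ U, valuation F (u : F) = 1)
    (hUsep : ∀ u ∈ U, ∀ u' ∈ U, u ≠ u' → valuation F (ϖ ^ (ℓ : ℤ)) < valuation F ((u : F) - u'))
    {v : V} (hv : ∀ g ∈ congruenceGL (m + 1) (valuation F (ϖ ^ (ℓ : ℤ))), ρ g v = v)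
    {C : ℝ} (hC0 : 0 ≤ C)
    (hC : ∀ w : V, (∀ g ∈ congruenceGL (m + 1) (valuation F (ϖ ^ (2 * L * (m + 1 : ℕ)))), ρ g w = w) →
      ‖Λ w‖ ^ 2 ≤ C * (B w w).re)
    (T : Finset ((Fin (m + 1) → ℤ) × (Fin (m + 1) → Fˣ)))
    (hT : ∀ p ∈ T, (p.1 (Fin.last m) = 0 ∧ p.2 (Fin.last m) = 1) ∧ (∀ i : Fin (m + 1), (i : ℕ) < m → p.2 i ∈ U) ∧
      ∀ i j : Fin (m + 1), i ≤ j → p.1 j ≤ p.1 i + ((j : ℤ) - i) * ℓ) :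
    ∑ p ∈ T, (Nat.card 𝓀[F] : ℝ) ^ (wtZ m p.1) * ‖Λ (ρ (torusElem hϖ.ne_zero p.1 p.2) v)‖ ^ 2 ≤
      C * (Nat.card 𝓀[F] : ℝ) ^ (ℓ * tri m) * ((Nat.card 𝓀[F] : ℝ))⁻¹ ^ eTot m L 0 * (B v v).re := by
  have hL : 1 ≤ L := by omega
  set q : ℝ := (Nat.card 𝓀[F] : ℝ) with hq
  have hq0 : 0 < q := Nat.cast_pos.2 Nat.card_pos
  set t₀ : GL (Fin (m + 1)) F := zpowDiagGL hϖ.ne_zero (gradExp (m + 1) L) with ht₀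
  -- the pointwise bound at each `p ∈ T`
  have hpt : ∀ p ∈ T, ‖Λ (ρ (torusElem hϖ.ne_zero p.1 p.2) v)‖ ^ 2 ≤
      C * q⁻¹ ^ eTot m L 0 * ((levelForm ρ ψ ϖ B m) (ρ (torusElem hϖ.ne_zero p.1 p.2) v)
        (ρ (torusElem hϖ.ne_zero p.1 p.2) v)).re := by
    intro p hp
    obtain ⟨⟨-, hpm⟩, hpU, hpla⟩ := hT p hp
    set y : V := ρ (t₀⁻¹ * torusElem hϖ.ne_zero p.1 p.2) v with hy
    have hxy : ρ (torusElem hϖ.ne_zero p.1 p.2) v = ρ t₀ y := by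
      rw [hy, ← Module.End.mul_apply, ← map_mul, mul_inv_cancel_left]
    -- a deep level fixing `y`
    obtain ⟨L₀, h2L, hy0⟩ : ∃ L₀ : ℤ, 2 * L ≤ L₀ ∧ ∀ g ∈ congruenceGL (m + 1) (valuation F (ϖ ^ L₀)), ρ g y = y := by
      obtain ⟨m₀, -, hm₀⟩ := exists_congruenceGL_pow_subset hϖ ((hρ y).mem_nhds (by
        change ρ 1 y = y; rw [map_one, Module.End.one_apply]))
      refine ⟨max (2 * L) m₀, le_max_left _ _, fun g hg => ?_⟩
      have hg' : g ∈ congruenceGL (m + 1) (valuation F ϖ ^ m₀) := by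
        refine congruenceGL_mono ?_ hg
        rw [← map_pow, ← zpow_natCast]
        exact valuation_zpow_le_of_le hϖ.ne_zero hϖ.valuation_le_one (le_max_right _ _)
      exact hm₀ hg'
    have hmu : ∀ i, valuation F (p.2 i : F) = 1 := by
      intro i
      by_cases hi : (i : ℕ) < m
      · exact hU1 _ (hpU i hi)
      · have : i = Fin.last m := Fin.ext (by have := i.2; rw [Fin.val_last]; omega)
        rw [this, hpm, Units.val_one, map_one]
    have hlow : ∀ b ∈ congruenceGL (m + 1) (valuation F (ϖ ^ L)),
        b ∈ oppositeParabolicGL F (id : Fin (m + 1) → Fin (m + 1)) → ρ b y = y :=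
      fun b hb hbl => apply_lower_torus_eq_self hϖ hℓ hLℓ hv hpla hmu hb hbl
    rw [hxy]
    exact norm_sq_whittaker_graded_le hϖ hψ hψ' hρ hLev hL h2L hy0 hlow hΛ hBi hC
  -- sum up with `bessel_bound_level`
  have hB := bessel_bound_level hϖ hψ hψ' hρ hLev hℓ hU1 hUsep hv T fun p hp => ⟨(hT p hp).1, (hT p hp).2.1⟩
  have hnn : ∀ p ∈ T, 0 ≤ ((levelForm ρ ψ ϖ B m) (ρ (torusElem hϖ.ne_zero p.1 p.2) v)
      (ρ (torusElem hϖ.ne_zero p.1 p.2) v)).re := fun p _ => (hLev m le_rfl).nonneg _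
  calc ∑ p ∈ T, q ^ (wtZ m p.1) * ‖Λ (ρ (torusElem hϖ.ne_zero p.1 p.2) v)‖ ^ 2
      ≤ ∑ p ∈ T, q ^ (wtZ m p.1) * (C * q⁻¹ ^ eTot m L 0 * ((levelForm ρ ψ ϖ B m) (ρ (torusElem hϖ.ne_zero p.1 p.2) v)
          (ρ (torusElem hϖ.ne_zero p.1 p.2) v)).re) :=
        Finset.sum_le_sum fun p hp => mul_le_mul_of_nonneg_left (hpt p hp) (zpow_nonneg hq0.le _)
    _ = C * q ^ (ℓ * tri m) * q⁻¹ ^ eTot m L 0 *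
          ∑ p ∈ T, q ^ (wtZ m p.1) * q⁻¹ ^ (ℓ * tri m) * ((levelForm ρ ψ ϖ B m) (ρ (torusElem hϖ.ne_zero p.1 p.2) v)
            (ρ (torusElem hϖ.ne_zero p.1 p.2) v)).re := by
        rw [Finset.mul_sum]
        refine Finset.sum_congr rfl fun p _ => ?_
        have : q ^ (ℓ * tri m) * q⁻¹ ^ (ℓ * tri m) = 1 := by rw [← mul_pow, mul_inv_cancel₀ hq0.ne', one_pow]
        calc q ^ wtZ m p.1 * (C * q⁻¹ ^ eTot m L 0 * _) = (q ^ (ℓ * tri m) * q⁻¹ ^ (ℓ * tri m)) *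
              (q ^ wtZ m p.1 * (C * q⁻¹ ^ eTot m L 0 * ((levelForm ρ ψ ϖ B m) (ρ (torusElem hϖ.ne_zero p.1 p.2) v)
                (ρ (torusElem hϖ.ne_zero p.1 p.2) v)).re)) := by rw [this, one_mul]
          _ = _ := by ring
    _ ≤ C * q ^ (ℓ * tri m) * q⁻¹ ^ eTot m L 0 * (B v v).re :=
        mul_le_mul_of_nonneg_left hB (mul_nonneg (mul_nonneg hC0 (pow_nonneg hq0.le _)) (pow_nonneg (inv_nonneg.2 hq0.le) _))

end Tower

/-! ### The support of Whittaker functions on the torus -/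

section Support

variable {m : ℕ} {V : Type*} [AddCommGroup V] [Module ℂ V]
  {ρ : Representation ℂ (GL (Fin (m + 1)) F) V} {ψ : AddChar F Circle} {ϖ : F}

omit [ValuativeRel F] in
/-- Conjugating a column element by a diagonal matrix of units rescales the column:
`D c_t(x) D⁻¹ = c_t(w_r x_r w_t⁻¹)`. [folklore] -/
theorem diagonalGL_mul_colElem_mul_inv (w : Fin (m + 1) → Fˣ) (t : Fin (m + 1)) (x : Fin (m + 1) → F) :
    diagonalGL (Fin (m + 1)) F w * colElem t x * (diagonalGL (Fin (m + 1)) F w)⁻¹ =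
      colElem t (fun r => (w r : F) * x r * ((w t : F))⁻¹) := by
  refine Units.ext (Matrix.ext fun r c => ?_)
  have h := coe_diagonalGL_inv_mul_mul_apply w⁻¹ (colElem t x) r c
  rw [map_inv, inv_inv] at h
  rw [h, coe_colElem, coe_colElem, Matrix.add_apply, Matrix.add_apply, colMat_apply, colMat_apply, Matrix.one_apply,
    Pi.inv_apply, Pi.inv_apply, Units.val_inv_eq_inv_val, Units.val_inv_eq_inv_val, inv_inv]
  by_cases hrc : r = c
  · subst hrc
    have : ¬ (r < t ∧ r = t) := fun h' => absurd h'.1 (h'.2 ▸ lt_irrefl _)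
    rw [if_pos rfl, if_neg this, if_neg this, add_zero]
    simp
  · rw [if_neg hrc, zero_add, zero_add]
    split_ifs with h'
    · rw [h'.2]
    · rw [mul_zero, zero_mul]

/-- **Support of Whittaker functions on the torus**: for `v` fixed by `K(ℓ)` and a `ψ`-Whittaker functional
`Λ` (`ψ` non-trivial on `ϖ⁻¹ 𝒪`), `Λ(ρ(ϖ^λ D_μ) v) = 0` as soon as `λ_{i+1} > λ_i + ℓ` for some `i` (the
unipotent `1 + c E_{i,i+1}`, `c ∈ ϖ^ℓ 𝒪`, fixes `v` and is moved past the torus). [folklore] -/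
theorem whittaker_torusElem_eq_zero (hϖ : IsUniformizingElement ϖ) (hψ' : ∃ c ∈ 𝒪[F], ψ (ϖ⁻¹ * c) ≠ 1)
    {Λ : Module.Dual ℂ V} (hΛ : Λ ∈ whittakerFunctionals ρ ψ) {ℓ : ℕ} {v : V}
    (hv : ∀ g ∈ congruenceGL (m + 1) (valuation F (ϖ ^ (ℓ : ℤ))), ρ g v = v)
    {la : Fin (m + 1) → ℤ} {mu : Fin (m + 1) → Fˣ} (hmu : ∀ i, valuation F (mu i : F) = 1)
    {i j : Fin (m + 1)} (hij : (i : ℕ) + 1 = j) (hgap : la i + ℓ < la j) :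
    Λ (ρ (torusElem hϖ.ne_zero la mu) v) = 0 := by
  obtain ⟨c₀, hc₀O, hc₀⟩ := hψ'
  set w : Fin (m + 1) → Fˣ := fun r => Units.mk0 ϖ hϖ.ne_zero ^ la r * mu r with hw
  have hd : torusElem hϖ.ne_zero la mu = diagonalGL (Fin (m + 1)) F w := by
    rw [torusElem, zpowDiagGL_eq_diagonalGL, ← map_mul]; rfl
  have hwval : ∀ r, valuation F (w r : F) = valuation F (ϖ ^ la r) := by
    intro r
    simp only [hw, Units.val_mul, Units.val_zpow_eq_zpow_val, Units.val_mk0, map_mul, hmu r, mul_one]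
  -- the unipotent `u = 1 + c E_{ij}` with `w_i c w_j⁻¹ = ϖ⁻¹ c₀`
  set c : F := ((w i : F))⁻¹ * (ϖ⁻¹ * c₀) * (w j : F) with hc
  have hcval : valuation F c ≤ valuation F (ϖ ^ (ℓ : ℤ)) := by
    rw [hc, map_mul, map_mul, map_inv₀, hwval, hwval, map_mul, map_inv₀]
    have hc₀v : valuation F c₀ ≤ 1 := (Valuation.mem_integer_iff _ _).1 hc₀O
    calc (valuation F (ϖ ^ la i))⁻¹ * ((valuation F ϖ)⁻¹ * valuation F c₀) * valuation F (ϖ ^ la j)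
        ≤ (valuation F (ϖ ^ la i))⁻¹ * ((valuation F ϖ)⁻¹ * 1) * valuation F (ϖ ^ la j) := by gcongr
      _ = valuation F (ϖ ^ (-la i + (-1) + la j)) := by
          rw [zpow_add₀ hϖ.ne_zero, zpow_add₀ hϖ.ne_zero, map_mul, map_mul, _root_.zpow_neg, map_inv₀, mul_one,
            _root_.zpow_neg, zpow_one, map_inv₀]
      _ ≤ valuation F (ϖ ^ (ℓ : ℤ)) := valuation_zpow_le_of_le hϖ.ne_zero hϖ.valuation_le_one (by omega)
  have hγ1 : valuation F (ϖ ^ (ℓ : ℤ)) ≤ 1 := by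
    rw [zpow_natCast, map_pow]; exact pow_le_one' hϖ.valuation_le_one _
  have hij' : i < j := Fin.lt_def.2 (by omega)
  have hu : colElem j (Pi.single i c) ∈ congruenceGL (m + 1) (valuation F (ϖ ^ (ℓ : ℤ))) := by
    refine colElem_mem_congruenceGL hγ1 fun r _ => ?_
    by_cases hri : r = i
    · subst hri; rw [Pi.single_eq_same]; exact hcval
    · rw [Pi.single_eq_of_ne hri, map_zero]; exact zero_le
  have hconj : torusElem hϖ.ne_zero la mu * colElem j (Pi.single i c) * (torusElem hϖ.ne_zero la mu)⁻¹ =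
      colElem j (Pi.single i (ϖ⁻¹ * c₀)) := by
    rw [hd, diagonalGL_mul_colElem_mul_inv]
    congr 1
    funext r
    by_cases hri : r = i
    · subst hri
      rw [Pi.single_eq_same, Pi.single_eq_same, hc]
      field_simp
    · rw [Pi.single_eq_of_ne hri, Pi.single_eq_of_ne hri, mul_zero, zero_mul]
  have key := (mem_whittakerFunctionals_iff Λ).1 hΛ ⟨colElem j (Pi.single i (ϖ⁻¹ * c₀)), colElem_mem_upperUnitriangular _ _⟩
    (ρ (torusElem hϖ.ne_zero la mu) v)
  have hself : Λ (ρ (torusElem hϖ.ne_zero la mu) v) = ψ (ϖ⁻¹ * c₀) * Λ (ρ (torusElem hϖ.ne_zero la mu) v) := by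
    conv_lhs => rw [← hv _ hu, ← Module.End.mul_apply, ← map_mul,
      show torusElem hϖ.ne_zero la mu * colElem j (Pi.single i c) =
        (torusElem hϖ.ne_zero la mu * colElem j (Pi.single i c) * (torusElem hϖ.ne_zero la mu)⁻¹) *
          torusElem hϖ.ne_zero la mu by group, map_mul, Module.End.mul_apply, hconj]
    rw [show ρ (colElem j (Pi.single i (ϖ⁻¹ * c₀))) = ρ ((⟨colElem j (Pi.single i (ϖ⁻¹ * c₀)),
      colElem_mem_upperUnitriangular _ _⟩ : ↥(upperUnitriangular (Fin (m + 1)) F)) : GL (Fin (m + 1)) F) from rfl, key,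
      whittakerCharFun_colElem ψ j i hij, Pi.single_eq_same]
  have hne : ((ψ (ϖ⁻¹ * c₀) : Circle) : ℂ) ≠ 1 := fun h => hc₀ (Circle.coe_inj.1 (by rwa [Circle.coe_one]))
  have h0 : (((ψ (ϖ⁻¹ * c₀) : Circle) : ℂ) - 1) * Λ (ρ (torusElem hϖ.ne_zero la mu) v) = 0 := by
    rw [sub_mul, one_mul, ← hself, sub_self]
  exact (mul_eq_zero.1 h0).resolve_left (sub_ne_zero.2 hne)

omit [ValuativeRel F] in
/-- Adjacent gaps control all gaps: `λ_{i+1} ≤ λ_i + ℓ` for all `i` implies `λ_j ≤ λ_i + (j - i) ℓ` for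
`i ≤ j`. [folklore] -/
theorem le_add_mul_of_adjacent {la : Fin (m + 1) → ℤ} {ℓ : ℤ}
    (h : ∀ i j : Fin (m + 1), (i : ℕ) + 1 = j → la j ≤ la i + ℓ) (i j : Fin (m + 1)) (hij : i ≤ j) :
    la j ≤ la i + ((j : ℤ) - i) * ℓ := by
  suffices ∀ k : ℕ, ∀ i j : Fin (m + 1), (j : ℕ) = i + k → la j ≤ la i + k * ℓ by
    have := this ((j : ℕ) - i) i j (by have := Fin.le_def.1 hij; omega)
    have e : (((j : ℕ) - (i : ℕ) : ℕ) : ℤ) = (j : ℤ) - i := by have := Fin.le_def.1 hij; omega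
    rwa [e] at this
  intro k
  induction k with
  | zero => intro i j h0; have : j = i := Fin.ext (by omega); subst this; simp
  | succ k ih =>
    intro i j hk
    have hj' : (i : ℕ) + k < m + 1 := by have := j.2; omega
    have h1 := ih i ⟨(i : ℕ) + k, hj'⟩ rfl
    have h2 := h ⟨(i : ℕ) + k, hj'⟩ j (by simp only; omega)
    push_cast at h1 h2 ⊢
    linarith

end Support

/-! ### The bound on an arbitrary torus box -/

section AllShells

variable [TopologicalSpace F] [IsNonarchimedeanLocalField F] {m : ℕ}
  {V : Type*} [AddCommGroup V] [Module ℂ V]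
  {ρ : Representation ℂ (GL (Fin (m + 1)) F) V} {ψ : AddChar F Circle} {ϖ : F}

/-- **The Kirillov `L²`-bound on an arbitrary finite torus box** (no window hypothesis): the terms outside
the near-antitone window vanish (`whittaker_torusElem_eq_zero`), the others are bounded by
`sum_norm_sq_whittaker_le`. For `v` fixed by `K(ℓ)`, `ℓ ≥ 1`, `L ≥ ℓ`, units `U` pairwise incongruent
modulo `ϖ^ℓ`, a bound `|Λ w|² ≤ C · B(w, w)` on the vectors of level `K(ϖ^{2L(m+1)})`, and every finite set `T`
of pairs `(λ, μ)` with `λ_m = 0`, `μ_m = 1`, `μ_i ∈ U` (`i < m`):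
`∑_{(λ,μ) ∈ T} q^{w(λ)} |Λ(ρ(ϖ^λ D_μ) v)|² ≤ C q^{ℓ m(m+1)/2} q^{-E_0} B(v, v)`.
[cite: JacquetShalikaAJM1981, §1] -/
theorem sum_norm_sq_whittaker_le_of_shells (hϖ : IsUniformizingElement ϖ) (hψ : ∀ c ∈ 𝒪[F], ψ c = 1)
    (hψ' : ∃ c ∈ 𝒪[F], ψ (ϖ⁻¹ * c) ≠ 1) (hρ : ρ.IsSmooth) {Λ : Module.Dual ℂ V} {B : V →ₗ⋆[ℂ] V →ₗ[ℂ] ℂ}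
    (hLev : ∀ k, k ≤ m → IsLevel ρ ψ hϖ.ne_zero Λ (levelForm ρ ψ ϖ B k) (col m k) k)
    (hΛ : Λ ∈ whittakerFunctionals ρ ψ)
    (hBi : ∀ (g : GL (Fin (m + 1)) F) (v w : V), B (ρ g v) (ρ g w) = B v w)
    {ℓ : ℕ} (hℓ : 1 ≤ ℓ) {L : ℤ} (hLℓ : (ℓ : ℤ) ≤ L) {U : Finset Fˣ} (hU1 : ∀ u ∈ U, valuation F (u : F) = 1)
    (hUsep : ∀ u ∈ U, ∀ u' ∈ U, u ≠ u' → valuation F (ϖ ^ (ℓ : ℤ)) < valuation F ((u : F) - u'))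
    {v : V} (hv : ∀ g ∈ congruenceGL (m + 1) (valuation F (ϖ ^ (ℓ : ℤ))), ρ g v = v)
    {C : ℝ} (hC0 : 0 ≤ C)
    (hC : ∀ w : V, (∀ g ∈ congruenceGL (m + 1) (valuation F (ϖ ^ (2 * L * (m + 1 : ℕ)))), ρ g w = w) →
      ‖Λ w‖ ^ 2 ≤ C * (B w w).re)
    (T : Finset ((Fin (m + 1) → ℤ) × (Fin (m + 1) → Fˣ)))
    (hT : ∀ p ∈ T, (p.1 (Fin.last m) = 0 ∧ p.2 (Fin.last m) = 1) ∧ ∀ i : Fin (m + 1), (i : ℕ) < m → p.2 i ∈ U) :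
    ∑ p ∈ T, (Nat.card 𝓀[F] : ℝ) ^ (wtZ m p.1) * ‖Λ (ρ (torusElem hϖ.ne_zero p.1 p.2) v)‖ ^ 2 ≤
      C * (Nat.card 𝓀[F] : ℝ) ^ (ℓ * tri m) * ((Nat.card 𝓀[F] : ℝ))⁻¹ ^ eTot m L 0 * (B v v).re := by
  classical
  set W : Finset ((Fin (m + 1) → ℤ) × (Fin (m + 1) → Fˣ)) :=
    T.filter fun p => ∀ i j : Fin (m + 1), (i : ℕ) + 1 = j → p.1 j ≤ p.1 i + ℓ with hW
  -- outside the window every term vanishes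
  have hzero : ∀ p ∈ T, p ∉ W →
      (Nat.card 𝓀[F] : ℝ) ^ (wtZ m p.1) * ‖Λ (ρ (torusElem hϖ.ne_zero p.1 p.2) v)‖ ^ 2 = 0 := by
    intro p hp hpW
    rw [hW, Finset.mem_filter, not_and] at hpW
    have h := hpW hp
    push Not at h
    obtain ⟨i, j, hij, hgap⟩ := h
    have hmu : ∀ i, valuation F (p.2 i : F) = 1 := by
      intro i
      by_cases hi : (i : ℕ) < m
      · exact hU1 _ ((hT p hp).2 i hi)
      · have : i = Fin.last m := Fin.ext (by have := i.2; rw [Fin.val_last]; omega)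
        rw [this, (hT p hp).1.2, Units.val_one, map_one]
    rw [whittaker_torusElem_eq_zero hϖ hψ' hΛ hv hmu hij hgap, norm_zero, zero_pow two_ne_zero, mul_zero]
  have hsplit : ∑ p ∈ T, (Nat.card 𝓀[F] : ℝ) ^ (wtZ m p.1) * ‖Λ (ρ (torusElem hϖ.ne_zero p.1 p.2) v)‖ ^ 2 =
      ∑ p ∈ W, (Nat.card 𝓀[F] : ℝ) ^ (wtZ m p.1) * ‖Λ (ρ (torusElem hϖ.ne_zero p.1 p.2) v)‖ ^ 2 := by
    rw [hW]
    exact (Finset.sum_filter_of_ne fun p hp hne => by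
      by_contra h
      exact hne (hzero p hp (by rw [hW, Finset.mem_filter, not_and]; exact fun _ => h))).symm
  rw [hsplit]
  refine sum_norm_sq_whittaker_le hϖ hψ hψ' hρ hLev hΛ hBi hℓ hLℓ hU1 hUsep hv hC0 hC W fun p hp => ?_
  rw [hW, Finset.mem_filter] at hp
  exact ⟨(hT p hp.1).1, (hT p hp.1).2, fun i j hij => le_add_mul_of_adjacent (fun i j h => hp.2 i j h) i j hij⟩

end AllShells

end WhittakerBessel

end Literature.NumberTheory.Automorphic
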